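import Literature.NumberTheory.GaloisRepresentations.NeukirchUchida
import Literature.NumberTheory.GaloisRepresentations.CohomologicalDimension
import Literature.AnabelianGeometry.AbsoluteAnabelian.NFSlimKummerProofs
import Literature.AnabelianGeometry.AbsoluteAnabelian.SlimTransport
import Mathlib.FieldTheory.KrullTopology
import HarnessLib

/-!
# The Neukirch–Uchida theorem, INJECTIVITY half: the field automorphism inducing a given
# isomorphism of open subgroups of `G_F` is unique ([NSW] (12.2.1); [AbsAnab] Thm 1.1.3)

J. Neukirch, A. Schmidt, K. Wingberg, *Cohomology of Number Fields*, Thm. (12.2.1) (Neukirch–Uchida),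
as quoted in S. Mochizuki, *The Absolute Anabelian Geometry of Hyperbolic Curves* [AbsAnab] Thm. 1.1.3
p. 6: for number fields `F₁, F₂` «the natural map `Isom(F̄₂/F₂, F̄₁/F₁) → Isom(Gal(F̄₁/F₁), Gal(F̄₂/F₂))`
is bijective».  The tree types the SURJECTIVITY (existence) half as the NAMED FACT
`Literature.NumberTheory.GaloisRepresentations.NeukirchUchida F` (abc-iut-w5-d201, `NeukirchUchida.lean`,
one-closure model: `U₁, U₂ ≤ G_F = Gal(F̄/F)` open, `α : U₁ ⥲ U₂`, a ring automorphism `τ` of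
`F̄ = AlgebraicClosure F` with `α(u)(τ x) = τ(u x)`), whose header records
«TODO(general form): … also asserts UNIQUENESS of `τ` (injectivity of the natural map)».

This PROOF-ONLY file (theorems, no definition, no instance, no named fact) PROVES the injectivity half
UNCONDITIONALLY — it needs no part of the Neukirch–Uchida fact, only the slimness of `G_ℚ`
([AbsAnab] Thm 1.1.1 (ii), the tree's THEOREM `galoisNF_slim_holds`):

* `ringEquiv_eq_refl_of_forall_map_smul` — an automorphism `ρ` of the field `F̄` that commutes with an
  OPEN subgroup `U` of `G_F` is the identity.  Proof: `ρ` is `ℚ`-linear, so lives in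
  `Γ := Aut_ℚ(F̄) ≅ G_ℚ` (`algEquivContinuousMulEquivAbsoluteGaloisGroup ℚ F̄`: `F̄` is an algebraic
  closure of `ℚ`), which is slim (`galoisNF_slim_holds ℚ`, transported by
  `isSlimGroup_of_continuousMulEquiv`); there `ρ` centralises the image of `U`, which contains
  `Gal(F̄/E)` for a subextension `E/F` finite (Krull basis), i.e. an OPEN subgroup of `Γ`; hence `ρ = 1`.
* `centralizer_map_restrictScalarsHom_eq_bot` — the same, as «the centraliser in `Aut_ℚ(F̄)` of (the
  image of) an open subgroup of `G_F` is trivial» (the hypothesis `Subgroup.centralizer S = ⊥` of the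
  profinite limit step `Literature.GroupTheory.LevelwiseConjugacyLimit.existsUnique_…`, abc-iut-w6-d055).
* `NeukirchUchida.ringEquiv_unique` — **injectivity**: two ring automorphisms `τ, τ'` of `F̄` inducing the
  same map `α : U₁ → U₂` (`U₁` open; `α` ANY function) by the N–U intertwining `α(u) • τ x = τ (u • x)`
  are equal; `NeukirchUchida.ringEquiv_unique_top` — the case `U₁ = U₂ = G_F`.
* `NeukirchUchida.existsUnique` — **bijectivity** of [AbsAnab] Thm 1.1.3 in the one-closure model:
  `∃! τ`, existence BY NAME from the fact `(h : NeukirchUchida F)`, uniqueness a theorem.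

abc-iut cell (seat abc-iut-w4-d016), campaign-L support of GAP-LEDGER row G-L4d2g4-1 (the N–U
deduction programme of abc-iut-L4-d2).  Classical algebraic number theory; nothing here bears on
[IUTchIII] Cor. 3.12 or takes a side; a named fact is a hypothesis, not a theorem.
-/

noncomputable section

open scoped Pointwise Topology

namespace Literature.AnabelianGeometry.AbsoluteAnabelian

open Field
open Literature.AlgebraicGeometry.Frobenioids (IsSlimGroup)
open Literature.NumberTheory.GaloisRepresentations

variable {F : Type} [Field F] [NumberField F]

/-! ### An automorphism of `F̄` commuting with an open subgroup of `G_F` is trivial -/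

/-- The absolute Galois group `Aut_ℚ(F̄)` of `ℚ`, computed in the algebraic closure `F̄` of a number field
`F`, is slim ([AbsAnab] Thm 1.1.1 (ii) for `ℚ`, `galoisNF_slim_holds`, transported along
`Aut_ℚ(F̄) ≃ₜ* G_ℚ`). [cite: MochizukiAbsAnab2004, Thm 1.1.1 (ii) p.6] -/
theorem isSlimGroup_ratAlgEquiv_algebraicClosure :
    IsSlimGroup (AlgebraicClosure F ≃ₐ[ℚ] AlgebraicClosure F) := by
  haveI : IsAlgClosure ℚ (AlgebraicClosure F) :=
    ⟨AlgebraicClosure.isAlgClosed F, Algebra.IsAlgebraic.trans ℚ F (AlgebraicClosure F)⟩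
  exact isSlimGroup_of_continuousMulEquiv
    (algEquivContinuousMulEquivAbsoluteGaloisGroup ℚ (AlgebraicClosure F)).symm (galoisNF_slim_holds ℚ)

/-- An element of `G_F = Gal(F̄/F)` as a `ℚ`-algebra automorphism of `F̄` (restriction of scalars to the
prime field; `Field.absoluteGaloisGroup F` is `F̄ ≃ₐ[F] F̄` through `absoluteGaloisGroup.toAlgEquiv`).
[cite: NeukirchSchmidtWingberg2008, Thm (12.2.1)] -/
theorem restrictScalarsHom_toAlgEquiv_apply (σ : absoluteGaloisGroup F) (x : AlgebraicClosure F) :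
    AlgEquiv.restrictScalarsHom ℚ (absoluteGaloisGroup.toAlgEquiv F σ) x = σ • x := rfl

/-- The image in `Aut_ℚ(F̄)` of an OPEN subgroup `U` of `G_F` is open: `U ⊇ Gal(F̄/E)` for some finite
`E/F` (Krull basis), and `Gal(F̄/E)`, `E/ℚ` finite, is open in `Aut_ℚ(F̄)`.
[cite: NeukirchSchmidtWingberg2008, Thm (12.2.1)] -/
theorem isOpen_map_restrictScalarsHom (U : Subgroup (absoluteGaloisGroup F))
    (hU : IsOpen (U : Set (absoluteGaloisGroup F))) :
    IsOpen ((U.map ((AlgEquiv.restrictScalarsHom ℚ).comp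
      (absoluteGaloisGroup.toAlgEquiv F).toMonoidHom) :
        Subgroup (AlgebraicClosure F ≃ₐ[ℚ] AlgebraicClosure F)) :
      Set (AlgebraicClosure F ≃ₐ[ℚ] AlgebraicClosure F)) := by
  -- a basic open `Gal(F̄/E) ⊆ U`, `E/F` finite (`Field.absoluteGaloisGroup F` is `F̄ ≃ₐ[F] F̄`)
  have hU1 : ((U : Set (absoluteGaloisGroup F)) : Set (AlgebraicClosure F ≃ₐ[F] AlgebraicClosure F)) ∈
      𝓝 (1 : AlgebraicClosure F ≃ₐ[F] AlgebraicClosure F) :=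
    hU.mem_nhds U.one_mem
  obtain ⟨E, hEfd, hEU⟩ := (krullTopology_mem_nhds_one_iff F (AlgebraicClosure F) _).mp hU1
  haveI := hEfd
  -- `E` as a finite subextension of `F̄/ℚ`
  let E' : IntermediateField ℚ (AlgebraicClosure F) := E.restrictScalars ℚ
  haveI : FiniteDimensional ℚ E' := by
    change FiniteDimensional ℚ E
    exact Module.Finite.trans F E
  refine Subgroup.isOpen_mono ?_ E'.fixingSubgroup_isOpen
  -- `Gal(Ω/E') ≤ image of U`: an automorphism fixing `E ⊇ F` pointwise is `F`-linear and lies in `Gal(Ω/E) ⊆ U`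
  intro σ hσ
  rw [IntermediateField.mem_fixingSubgroup_iff] at hσ
  have hσF : ∀ c : F, σ (algebraMap F (AlgebraicClosure F) c) = algebraMap F (AlgebraicClosure F) c :=
    fun c => hσ _ (show algebraMap F (AlgebraicClosure F) c ∈ E' from E.algebraMap_mem c)
  let σF : AlgebraicClosure F ≃ₐ[F] AlgebraicClosure F := AlgEquiv.ofRingEquiv (f := σ.toRingEquiv) hσF
  have hσFE : σF ∈ E.fixingSubgroup := by
    rw [IntermediateField.mem_fixingSubgroup_iff]
    intro x hx
    exact hσ x hx
  refine ⟨(absoluteGaloisGroup.toAlgEquiv F).symm σF, hEU hσFE, ?_⟩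
  ext x
  rfl

/-- **An automorphism of the field `F̄` commuting with an open subgroup of `G_F` is the identity**
(`F` a number field, `F̄ = AlgebraicClosure F`, `U ≤ G_F = Gal(F̄/F)` open, `ρ ∘ u = u ∘ ρ` on `F̄` for all
`u ∈ U`).  This is the injectivity half of the Neukirch–Uchida theorem [NSW] (12.2.1) / [AbsAnab]
Thm 1.1.3; it follows from the slimness of `G_ℚ` ([AbsAnab] Thm 1.1.1 (ii)): `ρ` is `ℚ`-linear and
centralises, in `Aut_ℚ(F̄) ≅ G_ℚ`, the open image of `U`. [cite: NeukirchSchmidtWingberg2008, Thm (12.2.1)]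
[cite: MochizukiAbsAnab2004, Thm 1.1.3 p.6] -/
theorem ringEquiv_eq_refl_of_forall_map_smul (U : Subgroup (absoluteGaloisGroup F))
    (hU : IsOpen (U : Set (absoluteGaloisGroup F))) (ρ : AlgebraicClosure F ≃+* AlgebraicClosure F)
    (h : ∀ (u : U) (x : AlgebraicClosure F),
      ρ ((u : absoluteGaloisGroup F) • x) = (u : absoluteGaloisGroup F) • ρ x) :
    ρ = RingEquiv.refl (AlgebraicClosure F) := by
  set Ω := AlgebraicClosure F
  -- `ρ` is `ℚ`-linear
  let ρ' : Ω ≃ₐ[ℚ] Ω := AlgEquiv.ofRingEquiv (f := ρ) fun q => by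
    rw [eq_ratCast (algebraMap ℚ Ω) q, map_ratCast]
  -- the open subgroup `W` of `Aut_ℚ(Ω)` it centralises
  set r : absoluteGaloisGroup F →* (Ω ≃ₐ[ℚ] Ω) :=
    (AlgEquiv.restrictScalarsHom ℚ).comp (absoluteGaloisGroup.toAlgEquiv F).toMonoidHom with hr
  have hW : IsOpen ((U.map r : Subgroup (Ω ≃ₐ[ℚ] Ω)) : Set (Ω ≃ₐ[ℚ] Ω)) :=
    isOpen_map_restrictScalarsHom U hU
  have hmem : ρ' ∈ Subgroup.centralizer ((U.map r : Subgroup (Ω ≃ₐ[ℚ] Ω)) : Set (Ω ≃ₐ[ℚ] Ω)) := by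
    rw [Subgroup.mem_centralizer_iff]
    rintro _ ⟨u, hu, rfl⟩
    ext x
    change r u (ρ x) = ρ (r u x)
    rw [hr, MonoidHom.comp_apply, MulEquiv.coe_toMonoidHom, restrictScalarsHom_toAlgEquiv_apply,
      restrictScalarsHom_toAlgEquiv_apply]
    exact (h ⟨u, hu⟩ x).symm
  rw [(isSlimGroup_ratAlgEquiv_algebraicClosure (F := F)).centralizer_eq_bot _ hW,
    Subgroup.mem_bot] at hmem
  ext x
  exact congrArg (fun e : Ω ≃ₐ[ℚ] Ω => e x) hmem

/-- **Centraliser form**: in `Aut_ℚ(F̄)`, the centraliser of (the image of) an open subgroup of `G_F` is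
trivial — the hypothesis `Subgroup.centralizer S = ⊥` of the profinite limit step of the N–U deduction
(`Literature.GroupTheory.LevelwiseConjugacyLimit`). [cite: NeukirchSchmidtWingberg2008, Thm (12.2.1)]
[cite: MochizukiAbsAnab2004, Thm 1.1.1 (ii) p.6] -/
theorem centralizer_map_restrictScalarsHom_eq_bot (U : Subgroup (absoluteGaloisGroup F))
    (hU : IsOpen (U : Set (absoluteGaloisGroup F))) :
    Subgroup.centralizer ((U.map ((AlgEquiv.restrictScalarsHom ℚ).comp
      (absoluteGaloisGroup.toAlgEquiv F).toMonoidHom) :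
        Subgroup (AlgebraicClosure F ≃ₐ[ℚ] AlgebraicClosure F)) :
      Set (AlgebraicClosure F ≃ₐ[ℚ] AlgebraicClosure F)) = ⊥ :=
  (isSlimGroup_ratAlgEquiv_algebraicClosure (F := F)).centralizer_eq_bot _
    (isOpen_map_restrictScalarsHom U hU)

/-! ### Injectivity and bijectivity of the natural map of [AbsAnab] Thm 1.1.3 -/

namespace NeukirchUchida

/-- **Neukirch–Uchida, injectivity half** ([NSW] (12.2.1); [AbsAnab] Thm 1.1.3 «the natural map … is
bijective», injectivity): for `U₁ ≤ G_F` OPEN, `U₂ ≤ G_F`, and ANY map `α : U₁ → U₂`, two automorphisms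
`τ, τ'` of the field `F̄` that both induce `α` by conjugation — `α(u) • τ x = τ (u • x)` and likewise for
`τ'` — are equal (apply `ringEquiv_eq_refl_of_forall_map_smul` to `τ'⁻¹ ∘ τ`).
[cite: NeukirchSchmidtWingberg2008, Thm (12.2.1)] [cite: MochizukiAbsAnab2004, Thm 1.1.3 p.6] -/
theorem ringEquiv_unique {U₁ U₂ : Subgroup (absoluteGaloisGroup F)}
    (hU₁ : IsOpen (U₁ : Set (absoluteGaloisGroup F))) (α : U₁ → U₂)
    {τ τ' : AlgebraicClosure F ≃+* AlgebraicClosure F}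
    (hτ : ∀ (u : U₁) (x : AlgebraicClosure F),
      ((α u : U₂) : absoluteGaloisGroup F) • τ x = τ ((u : absoluteGaloisGroup F) • x))
    (hτ' : ∀ (u : U₁) (x : AlgebraicClosure F),
      ((α u : U₂) : absoluteGaloisGroup F) • τ' x = τ' ((u : absoluteGaloisGroup F) • x)) :
    τ = τ' := by
  have key := ringEquiv_eq_refl_of_forall_map_smul U₁ hU₁ (τ.trans τ'.symm) fun u x => by
    change τ'.symm (τ ((u : absoluteGaloisGroup F) • x)) = (u : absoluteGaloisGroup F) • τ'.symm (τ x)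
    apply τ'.injective
    rw [RingEquiv.apply_symm_apply, ← hτ u x, ← hτ' u, RingEquiv.apply_symm_apply]
  ext x
  have hx : τ'.symm (τ x) = x := by
    change (τ.trans τ'.symm) x = x
    rw [key]
    rfl
  simpa using congrArg τ' hx

/-- The case `U₁ = U₂ = G_F` of `ringEquiv_unique`: the automorphism of `F̄` inducing a given
self-map `α` of `G_F` by conjugation (if any) is unique. [cite: NeukirchSchmidtWingberg2008, Thm (12.2.1)]
[cite: MochizukiAbsAnab2004, Thm 1.1.3 p.6] -/
theorem ringEquiv_unique_top (α : absoluteGaloisGroup F → absoluteGaloisGroup F)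
    {τ τ' : AlgebraicClosure F ≃+* AlgebraicClosure F}
    (hτ : ∀ (σ : absoluteGaloisGroup F) (x : AlgebraicClosure F), α σ • τ x = τ (σ • x))
    (hτ' : ∀ (σ : absoluteGaloisGroup F) (x : AlgebraicClosure F), α σ • τ' x = τ' (σ • x)) :
    τ = τ' :=
  ringEquiv_unique (U₁ := ⊤) (U₂ := ⊤) isOpen_univ (fun u => ⟨α u, Subgroup.mem_top _⟩)
    (fun u x => hτ u x) (fun u x => hτ' u x)

/-- **[AbsAnab] Thm 1.1.3, BIJECTIVITY, in the one-closure model**: under the Neukirch–Uchida fact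
`NeukirchUchida F` (existence, a HYPOTHESIS), for `U₁, U₂ ≤ G_F` open and a topological isomorphism
`α : U₁ ⥲ U₂` there is EXACTLY ONE automorphism `τ` of the field `F̄` with `α(u) • τ x = τ (u • x)` —
existence by name from the fact, uniqueness by `ringEquiv_unique` (a theorem).
[cite: NeukirchSchmidtWingberg2008, Thm (12.2.1)] [cite: MochizukiAbsAnab2004, Thm 1.1.3 p.6] -/
theorem existsUnique (h : NeukirchUchida F) {U₁ U₂ : Subgroup (absoluteGaloisGroup F)}
    (hU₁ : IsOpen (U₁ : Set (absoluteGaloisGroup F))) (hU₂ : IsOpen (U₂ : Set (absoluteGaloisGroup F)))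
    (α : U₁ ≃ₜ* U₂) :
    ∃! τ : AlgebraicClosure F ≃+* AlgebraicClosure F,
      ∀ (u : U₁) (x : AlgebraicClosure F),
        ((α u : U₂) : absoluteGaloisGroup F) • τ x = τ ((u : absoluteGaloisGroup F) • x) := by
  obtain ⟨τ, hτ⟩ := h U₁ U₂ hU₁ hU₂ α
  exact ⟨τ, hτ, fun τ' hτ' => ringEquiv_unique hU₁ (fun u => α u) hτ' hτ⟩

/-- **(N0), bijective form**: under `NeukirchUchida F`, every topological automorphism `α` of `G_F` is
conjugation by EXACTLY ONE automorphism of the field `F̄`. [cite: NeukirchSchmidtWingberg2008, Thm (12.2.1)]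
[cite: MochizukiAbsAnab2004, Thm 1.1.3 p.6] -/
theorem existsUnique_top (h : NeukirchUchida F) (α : absoluteGaloisGroup F ≃ₜ* absoluteGaloisGroup F) :
    ∃! τ : AlgebraicClosure F ≃+* AlgebraicClosure F,
      ∀ (σ : absoluteGaloisGroup F) (x : AlgebraicClosure F), α σ • τ x = τ (σ • x) := by
  obtain ⟨τ, hτ⟩ := NeukirchUchida.exists_ringEquiv_conj h α
  exact ⟨τ, hτ, fun τ' hτ' => ringEquiv_unique_top (fun σ => α σ) hτ' hτ⟩

end NeukirchUchida

end Literature.AnabelianGeometry.AbsoluteAnabelian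

end
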